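import Literature.ComputerArithmetic.Rump2006.CholeskyReciprocalDivisionSharp

/-!
# Reciprocal pivot scaling costs NOTHING in Rump's constants, part 2: Lemma 10.13, Theorem 2.3 and
# the positive-definiteness criteria for a `CholeskyRunRecip u` with the SAME `u`

HONEST FRAMING (cell certnum, L1; seat certnum-ila-3): tools and soundness statements; every certified
number belongs to a client cell's ledger. Part 1 (`CholeskyReciprocalDivisionSharp`) proved the
entrywise backward error `γ_{min(i,j)+2}` and the column bound (10.57) for a floating-point Cholesky
with reciprocal pivot scaling (library `dpotrf`/`dtrsm` shape) at the SAME unit roundoff `u`. This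
part carries them to the quadratic form and the criteria, re-tracing the parent file
(`CholeskyPositiveDefinite`): [Rump2010Verification] Lemma 10.13 (`|xᵀ(A − R̃ᵀR̃)x| ≤ (Σ_j φ_{j+2} a_jj) xᵀx`),
[Rump2006] Theorem 2.3 (both forms), Corollary 2.4 (and its a-priori form, §10.8.1 `isspd`), the
`Matrix.PosDef` packaging over `ℝ`, and Corollary 2.7 / Lemma 10.14 with (10.61) — all for a
`CholeskyRunRecip u A R̃` with the PRINTED constants (`u`, not `2u+u²`). The AM–GM / Schur bookkeeping
of Lemma 10.13 is stated once from the two matrix-level facts (`abs_quadForm_le_of_entrywise_and_columns`),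
so any future run shape with those two facts inherits it. These are the statements an engine may cite
for a LAPACK / CHOLMOD factorization at `u = 2⁻⁵³` without doubling its shift constant
(cap.ila.psd `fpapriori` «certified-fp»; cap.ila.spd `SPD_THEOREMS`). No named facts, no `sorry`.
WHAT IS NOT HERE: as in the parent — underflow (`eta`) terms, complex data, sparsity-aware counts,
TRSM-by-block-inversion libraries, the IEEE formats themselves.
-/

namespace Literature.ComputerArithmetic.Rump2006

open Finset Matrix
open Literature.ComputerArithmetic.Higham2002

variable {K : Type*} [Field K] [LinearOrder K] [IsStrictOrderedRing K]

section Cholesky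

variable {u : K} {n : ℕ}

/-- The quadratic-form bound of [Rump2010Verification] Lemma 10.13 from the two MATRIX-LEVEL facts
only (entrywise `|D i j| ≤ γ_{min(i,j)+2} Σ_k |r̃_ki||r̃_kj|` and the column bounds): the AM–GM / Schur
bookkeeping of the parent proof, stated once for any run shape. [cite: Rump2010Verification, Lemma 10.13] -/
theorem abs_quadForm_le_of_entrywise_and_columns (hu : 0 ≤ u) (h2n : 2 * ((n : K) + 1) * u < 1)
    {A R D : Matrix (Fin n) (Fin n) K}
    (hDij : ∀ i j, |D i j| ≤ gamma u (min i.val j.val + 2) * ∑ k, |R k i| * |R k j|)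
    (hcol : ∀ j : Fin n, ∑ k, R k j ^ 2 ≤ (1 - gamma u (j.val + 2))⁻¹ * A j j)
    (x : Fin n → K) :
    |x ⬝ᵥ (D *ᵥ x)| ≤
      (∑ j : Fin n, gamma u (j.val + 2) / (1 - gamma u (j.val + 2)) * A j j) * (x ⬝ᵥ x) := by
  have hidx : ∀ i : Fin n, (((i.val + 2 : ℕ) : K)) * u < 1 := by
    intro i
    have : (i.val : K) + 2 ≤ n + 1 := by exact_mod_cast (by omega : i.val + 2 ≤ n + 1)
    push_cast; nlinarith
  have hγ0 : ∀ i : Fin n, 0 ≤ gamma u (i.val + 2) := fun i => gamma_nonneg hu (hidx i)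
  have hγm0 : ∀ i j : Fin n, 0 ≤ gamma u (min i.val j.val + 2) := by
    intro i j
    rcases le_total i.val j.val with hh | hh
    · rw [min_eq_left hh]; exact hγ0 i
    · rw [min_eq_right hh]; exact hγ0 j
  have hγmi : ∀ i j : Fin n, gamma u (min i.val j.val + 2) ≤ gamma u (i.val + 2) :=
    fun i j => gamma_mono hu (by omega) (hidx i)
  have hγmj : ∀ i j : Fin n, gamma u (min i.val j.val + 2) ≤ gamma u (j.val + 2) :=
    fun i j => gamma_mono hu (by omega) (hidx j)
  set P : Fin n → Fin n → Fin n → K := fun i j k => gamma u (i.val + 2) * (x j ^ 2 * R k i ^ 2)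
    with hP
  have hC : ∀ i j k : Fin n, gamma u (min i.val j.val + 2) * ((|x i| * |R k j|) * (|x j| * |R k i|))
      ≤ (P i j k + P j i k) / 2 := by
    intro i j k
    simp only [hP]
    set a := |x j| * |R k i|
    set b := |x i| * |R k j|
    have ha : a ^ 2 = x j ^ 2 * R k i ^ 2 := by rw [mul_pow, sq_abs, sq_abs]
    have hb : b ^ 2 = x i ^ 2 * R k j ^ 2 := by rw [mul_pow, sq_abs, sq_abs]
    rw [← ha, ← hb]
    have h1 : gamma u (min i.val j.val + 2) * (b * a) ≤
        gamma u (min i.val j.val + 2) * ((a ^ 2 + b ^ 2) / 2) :=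
      mul_le_mul_of_nonneg_left (by nlinarith [sq_nonneg (a - b)]) (hγm0 i j)
    have h2 : gamma u (min i.val j.val + 2) * a ^ 2 ≤ gamma u (i.val + 2) * a ^ 2 :=
      mul_le_mul_of_nonneg_right (hγmi i j) (sq_nonneg a)
    have h3 : gamma u (min i.val j.val + 2) * b ^ 2 ≤ gamma u (j.val + 2) * b ^ 2 :=
      mul_le_mul_of_nonneg_right (hγmj i j) (sq_nonneg b)
    linarith
  have hterm : ∀ i j : Fin n, |x i * (D i j * x j)| ≤ ∑ k, (P i j k + P j i k) / 2 := by
    intro i j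
    have h1 : |x i * (D i j * x j)| ≤
        |x i| * |x j| * (gamma u (min i.val j.val + 2) * ∑ k, |R k i| * |R k j|) := by
      rw [abs_mul, abs_mul]
      calc |x i| * (|D i j| * |x j|) = |x i| * |x j| * |D i j| := by ring
        _ ≤ _ := mul_le_mul_of_nonneg_left (hDij i j) (by positivity)
    have h2 : |x i| * |x j| * (gamma u (min i.val j.val + 2) * ∑ k, |R k i| * |R k j|) =
        ∑ k, gamma u (min i.val j.val + 2) * ((|x i| * |R k j|) * (|x j| * |R k i|)) := by
      rw [mul_sum, mul_sum]
      exact sum_congr rfl fun k _ => by ring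
    rw [h2] at h1
    exact h1.trans (sum_le_sum fun k _ => hC i j k)
  have hPsum : ∑ i, ∑ j, ∑ k, P i j k =
      (∑ i : Fin n, gamma u (i.val + 2) * ∑ k, R k i ^ 2) * ∑ j, x j ^ 2 := by
    have inner : ∀ i : Fin n, ∑ j, ∑ k, P i j k =
        gamma u (i.val + 2) * ((∑ k, R k i ^ 2) * ∑ j, x j ^ 2) := by
      intro i
      rw [Finset.sum_mul_sum, Finset.mul_sum, Finset.sum_comm]
      refine sum_congr rfl fun k _ => ?_
      rw [Finset.mul_sum]
      exact sum_congr rfl fun j _ => by simp only [hP]; ring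
    rw [sum_congr rfl fun i _ => inner i, Finset.sum_mul]
    exact sum_congr rfl fun i _ => by ring
  have hQsum : ∑ i, ∑ j, ∑ k, P j i k =
      (∑ i : Fin n, gamma u (i.val + 2) * ∑ k, R k i ^ 2) * ∑ j, x j ^ 2 := by
    rw [sum_comm]; exact hPsum
  have hRHS : ∑ i, ∑ j, ∑ k, (P i j k + P j i k) / 2 =
      (∑ i : Fin n, gamma u (i.val + 2) * ∑ k, R k i ^ 2) * ∑ j, x j ^ 2 := by
    calc ∑ i, ∑ j, ∑ k, (P i j k + P j i k) / 2
        = ∑ i, ∑ j, ∑ k, (P i j k / 2 + P j i k / 2) := by simp only [add_div]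
      _ = (∑ i, ∑ j, ∑ k, P i j k / 2) + ∑ i, ∑ j, ∑ k, P j i k / 2 := by
          simp only [sum_add_distrib]
      _ = (∑ i, ∑ j, ∑ k, P i j k) / 2 + (∑ i, ∑ j, ∑ k, P j i k) / 2 := by
          simp only [Finset.sum_div]
      _ = _ := by rw [hPsum, hQsum, add_halves]
  have hxx : x ⬝ᵥ x = ∑ j, x j ^ 2 := by
    simp only [dotProduct]; exact sum_congr rfl fun j _ => (sq _).symm
  have hN0 : 0 ≤ ∑ j, x j ^ 2 := sum_nonneg fun j _ => sq_nonneg _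
  have hT : (∑ i : Fin n, gamma u (i.val + 2) * ∑ k, R k i ^ 2) ≤
      ∑ i : Fin n, gamma u (i.val + 2) / (1 - gamma u (i.val + 2)) * A i i := by
    refine sum_le_sum fun i _ => ?_
    rw [div_eq_mul_inv, mul_assoc]
    exact mul_le_mul_of_nonneg_left (hcol i) (hγ0 i)
  have hexp : x ⬝ᵥ (D *ᵥ x) = ∑ i, ∑ j, x i * (D i j * x j) := by
    simp only [dotProduct, mulVec, mul_sum]
  rw [hexp, hxx]
  calc |∑ i, ∑ j, x i * (D i j * x j)| ≤ ∑ i, |∑ j, x i * (D i j * x j)| := abs_sum_le_sum_abs _ _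
    _ ≤ ∑ i, ∑ j, |x i * (D i j * x j)| := sum_le_sum fun i _ => abs_sum_le_sum_abs _ _
    _ ≤ ∑ i, ∑ j, ∑ k, (P i j k + P j i k) / 2 :=
        sum_le_sum fun i _ => sum_le_sum fun j _ => hterm i j
    _ = (∑ i : Fin n, gamma u (i.val + 2) * ∑ k, R k i ^ 2) * ∑ j, x j ^ 2 := hRHS
    _ ≤ _ := mul_le_mul_of_nonneg_right hT hN0

namespace CholeskyRunRecip

variable {A R : Matrix (Fin n) (Fin n) K}

/-- [Rump2010Verification] LEMMA 10.13 FOR A RECIPROCAL RUN, SAME CONSTANT: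
`|xᵀ (A - R̃ᵀR̃) x| ≤ (Σ_j φ_{j+2} a_{jj}) xᵀx`, `φ_m = γ_m (1 - γ_m)⁻¹` (0-based `j`), under
`2(n+1)u < 1`. [cite: Rump2010Verification, Lemma 10.13] [cite: Rump2006, Theorem 2.3] -/
theorem abs_quadForm_sub_le (hu : 0 ≤ u) (h2n : 2 * ((n : K) + 1) * u < 1) (hA : Aᵀ = A)
    (h : CholeskyRunRecip u A R) (x : Fin n → K) :
    |x ⬝ᵥ ((A - Rᵀ * R) *ᵥ x)| ≤
      (∑ j : Fin n, gamma u (j.val + 2) / (1 - gamma u (j.val + 2)) * A j j) * (x ⬝ᵥ x) := by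
  have hn : ((n : K) + 1) * u < 1 := by nlinarith [Nat.cast_nonneg (α := K) n]
  exact abs_quadForm_le_of_entrywise_and_columns hu h2n
    (fun i j => by rw [Matrix.sub_apply]; exact h.abs_sub_transpose_mul_self_le hu hn hA i j)
    (fun j => (h.sum_sq_le hu h2n j).1) x

/-- [Rump2006] THEOREM 2.3 FOR A RECIPROCAL RUN, SAME CONSTANT: `xᵀ A x ≥ -(Σ_j φ_{j+2} a_{jj}) xᵀx`.
[cite: Rump2006, Theorem 2.3] [cite: Rump2010Verification, Lemma 10.13] -/
theorem neg_mul_le_quadForm (hu : 0 ≤ u) (h2n : 2 * ((n : K) + 1) * u < 1) (hA : Aᵀ = A)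
    (h : CholeskyRunRecip u A R) (x : Fin n → K) :
    -(∑ j : Fin n, gamma u (j.val + 2) / (1 - gamma u (j.val + 2)) * A j j) * (x ⬝ᵥ x) ≤
      x ⬝ᵥ (A *ᵥ x) := by
  have hq := h.abs_quadForm_sub_le hu h2n hA x
  have hsplit : x ⬝ᵥ (A *ᵥ x) = (R *ᵥ x) ⬝ᵥ (R *ᵥ x) + x ⬝ᵥ ((A - Rᵀ * R) *ᵥ x) := by
    rw [sub_mulVec, dotProduct_sub, ← CholeskyRun.dotProduct_transpose_mul_self_mulVec]; ring
  have hgram : 0 ≤ (R *ᵥ x) ⬝ᵥ (R *ᵥ x) := sum_nonneg fun i _ => mul_self_nonneg _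
  rw [hsplit]
  linarith [neg_abs_le (x ⬝ᵥ ((A - Rᵀ * R) *ᵥ x))]

/-- [Rump2006] THEOREM 2.3, strict form (positive computed pivots, Roux's `cholesky_success`) FOR A
RECIPROCAL RUN, SAME CONSTANT: `xᵀ A x > -(Σ_j φ_{j+2} a_{jj}) xᵀx` for `x ≠ 0`. [cite: Rump2006, Theorem 2.3] -/
theorem neg_mul_lt_quadForm (hu : 0 ≤ u) (h2n : 2 * ((n : K) + 1) * u < 1) (hA : Aᵀ = A)
    (h : CholeskyRunRecip u A R) (hpos : ∀ j, 0 < R j j) (x : Fin n → K) (hx : x ≠ 0) :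
    -(∑ j : Fin n, gamma u (j.val + 2) / (1 - gamma u (j.val + 2)) * A j j) * (x ⬝ᵥ x) <
      x ⬝ᵥ (A *ᵥ x) := by
  have hq := h.abs_quadForm_sub_le hu h2n hA x
  have hsplit : x ⬝ᵥ (A *ᵥ x) = (R *ᵥ x) ⬝ᵥ (R *ᵥ x) + x ⬝ᵥ ((A - Rᵀ * R) *ᵥ x) := by
    rw [sub_mulVec, dotProduct_sub, ← CholeskyRun.dotProduct_transpose_mul_self_mulVec]; ring
  have hdet : R.det ≠ 0 := by
    rw [Matrix.det_of_upperTriangular (fun i j hij => h.lower i j hij)]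
    exact prod_ne_zero_iff.mpr fun j _ => (hpos j).ne'
  have hinj : Function.Injective R.mulVec :=
    Matrix.mulVec_injective_iff_isUnit.mpr
      ((Matrix.isUnit_iff_isUnit_det R).mpr (isUnit_iff_ne_zero.mpr hdet))
  have hRx : R *ᵥ x ≠ 0 := by
    intro h0
    apply hx
    apply hinj
    rw [h0, mulVec_zero]
  obtain ⟨i, hi⟩ := Function.ne_iff.mp hRx
  have hgram : 0 < (R *ᵥ x) ⬝ᵥ (R *ᵥ x) :=
    sum_pos' (fun k _ => mul_self_nonneg _) ⟨i, mem_univ _, mul_self_pos.mpr hi⟩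
  rw [hsplit]
  linarith [neg_abs_le (x ⬝ᵥ ((A - Rᵀ * R) *ᵥ x))]

end CholeskyRunRecip

/-! ### The criteria for a reciprocal run, with the PRINTED constants (`u`, not `2u+u²`) -/

/-- [Rump2006] COROLLARY 2.4 / [Rump2010Verification] §10.8.1 (`isspd`) FOR A LIBRARY-SHAPE RUN, SAME
CONSTANTS: `Ã` agrees with the symmetric `A` off the diagonal, `ã_{jj} ≤ a_{jj} - c`, the Cholesky of `Ã`
with reciprocal pivot scaling runs to completion with positive computed pivots, `2(n+1)u < 1` and
`Σ_j φ_{j+2} ã_{jj} ≤ c` ⟹ `xᵀAx > 0` for `x ≠ 0`. [cite: Rump2006, Corollary 2.4] [cite: Rump2010Verification, Section 10.8.1] -/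
theorem quadForm_pos_of_shifted_cholesky_recip_sharp {u : K} (hu : 0 ≤ u)
    (h2n : 2 * ((n : K) + 1) * u < 1) {A At R : Matrix (Fin n) (Fin n) K} (hAt : Atᵀ = At)
    (hrun : CholeskyRunRecip u At R) (hpos : ∀ j, 0 < R j j) {c : K}
    (hoff : ∀ i j, i ≠ j → At i j = A i j) (hdiag : ∀ i, At i i ≤ A i i - c)
    (hc : ∑ j : Fin n, gamma u (j.val + 2) / (1 - gamma u (j.val + 2)) * At j j ≤ c)
    (x : Fin n → K) (hx : x ≠ 0) : 0 < x ⬝ᵥ (A *ᵥ x) := by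
  have h1 := hrun.neg_mul_lt_quadForm hu h2n hAt hpos x hx
  have h2 := quadForm_shift_le hoff hdiag x
  have hxx : 0 ≤ x ⬝ᵥ x := sum_nonneg fun i _ => mul_self_nonneg _
  nlinarith [mul_le_mul_of_nonneg_right hc hxx]

/-- The same with the A-PRIORI constant from `A`'s own diagonal ([Rump2010Verification] §10.8.1), FOR A
LIBRARY-SHAPE RUN, SAME CONSTANTS: `0 ≤ c`, `Σ_j φ_{j+2} a_{jj} ≤ c`.
[cite: Rump2010Verification, Section 10.8.1] [cite: Rump2006, Corollary 2.4] -/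
theorem quadForm_pos_of_shifted_cholesky_apriori_recip_sharp {u : K} (hu : 0 ≤ u)
    (h2n : 2 * ((n : K) + 1) * u < 1) {A At R : Matrix (Fin n) (Fin n) K} (hAt : Atᵀ = At)
    (hrun : CholeskyRunRecip u At R) (hpos : ∀ j, 0 < R j j) {c : K} (hc0 : 0 ≤ c)
    (hoff : ∀ i j, i ≠ j → At i j = A i j) (hdiag : ∀ i, At i i ≤ A i i - c)
    (hc : ∑ j : Fin n, gamma u (j.val + 2) / (1 - gamma u (j.val + 2)) * A j j ≤ c)
    (x : Fin n → K) (hx : x ≠ 0) : 0 < x ⬝ᵥ (A *ᵥ x) := by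
  refine quadForm_pos_of_shifted_cholesky_recip_sharp hu h2n hAt hrun hpos hoff hdiag
    (le_trans ?_ hc) x hx
  refine sum_le_sum fun j _ => mul_le_mul_of_nonneg_left (by linarith [hdiag j]) ?_
  have hj : (((j.val + 2 : ℕ) : K)) * u < 1 := by
    have : (j.val : K) + 2 ≤ n + 1 := by exact_mod_cast (by omega : j.val + 2 ≤ n + 1)
    push_cast; nlinarith
  have hglt : gamma u (j.val + 2) < 1 := gamma_lt_one (by
    have : (j.val : K) + 2 ≤ n + 1 := by exact_mod_cast (by omega : j.val + 2 ≤ n + 1)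
    push_cast; nlinarith)
  exact div_nonneg (gamma_nonneg hu hj) (by linarith)

/-- [Rump2006] COROLLARY 2.4 over `ℝ`, packaged as Mathlib's `Matrix.PosDef`, FOR A LIBRARY-SHAPE RUN
(reciprocal pivot scaling) with the PRINTED constants — the statement an engine may cite for a LAPACK /
CHOLMOD factorization at `u = 2⁻⁵³` without doubling `c`.
[cite: Rump2006, Corollary 2.4] [cite: Rump2010Verification, Section 10.8.1] -/
theorem posDef_of_shifted_cholesky_recip_sharp {n : ℕ} {u : ℝ} (hu : 0 ≤ u)
    (h2n : 2 * ((n : ℝ) + 1) * u < 1) {A At R : Matrix (Fin n) (Fin n) ℝ} (hAt : Atᵀ = At)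
    (hrun : CholeskyRunRecip u At R) (hpos : ∀ j, 0 < R j j) {c : ℝ}
    (hoff : ∀ i j, i ≠ j → At i j = A i j) (hdiag : ∀ i, At i i ≤ A i i - c)
    (hc : ∑ j : Fin n, gamma u (j.val + 2) / (1 - gamma u (j.val + 2)) * At j j ≤ c) :
    A.PosDef := by
  have hA : A.IsHermitian := by
    rw [Matrix.IsHermitian, Matrix.conjTranspose_eq_transpose_of_trivial]
    ext i j
    rw [Matrix.transpose_apply]
    by_cases hij : i = j
    · rw [hij]
    · have h1 := hoff j i (Ne.symm hij)
      have h2 := hoff i j hij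
      have h3 : At j i = At i j := by
        have := congrFun (congrFun hAt i) j
        rw [Matrix.transpose_apply] at this
        exact this
      rw [← h1, h3, h2]
  refine Matrix.PosDef.of_dotProduct_mulVec_pos hA fun x hx => ?_
  rw [star_trivial]
  exact quadForm_pos_of_shifted_cholesky_recip_sharp hu h2n hAt hrun hpos hoff hdiag hc x hx

/-- [Rump2010Verification] LEMMA 10.14 with (10.61) (interval input, root-free Collatz bound) FOR A
LIBRARY-SHAPE RUN, SAME CONSTANTS. [cite: Rump2010Verification, Lemma 10.14 and (10.61)] [cite: Rump2006, Corollary 2.7] -/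
theorem quadForm_pos_of_shifted_cholesky_interval'_recip_sharp {u : K} (hu : 0 ≤ u)
    (h2n : 2 * ((n : K) + 1) * u < 1) {A At R Rad : Matrix (Fin n) (Fin n) K} (hAt : Atᵀ = At)
    (hrun : CholeskyRunRecip u At R) (hpos : ∀ j, 0 < R j j) (hRad0 : ∀ i j, 0 ≤ Rad i j)
    {v : Fin n → K} (hv : ∀ i, 0 < v i) {μ r c : K} (hμ : ∀ i, (Radᵀ *ᵥ (Rad *ᵥ v)) i ≤ μ * v i)
    (hμr : μ ≤ r ^ 2) (hr0 : 0 ≤ r) (hoff : ∀ i j, i ≠ j → At i j = A i j)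
    (hdiag : ∀ i, At i i ≤ A i i - c - r)
    (hc : ∑ j : Fin n, gamma u (j.val + 2) / (1 - gamma u (j.val + 2)) * At j j ≤ c)
    (X : Matrix (Fin n) (Fin n) K) (hX : ∀ i j, |X i j - A i j| ≤ Rad i j)
    (y : Fin n → K) (hy : y ≠ 0) : 0 < y ⬝ᵥ (X *ᵥ y) := by
  have h1 := hrun.neg_mul_lt_quadForm hu h2n hAt hpos y hy
  have h2 := quadForm_shift_le (d := c + r) hoff (fun i => by linarith [hdiag i]) y
  have h3 := quadForm_sub_abs_le hX y
  set ya : Fin n → K := fun i => |y i| with hya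
  have hN : (Radᵀ * Rad)ᵀ = Radᵀ * Rad := by rw [transpose_mul, transpose_transpose]
  have hN0 : ∀ i j, 0 ≤ (Radᵀ * Rad) i j := fun i j => by
    rw [Matrix.mul_apply]; exact sum_nonneg fun k _ => mul_nonneg (hRad0 k i) (hRad0 k j)
  have hNv : ∀ i, ((Radᵀ * Rad) *ᵥ v) i ≤ μ * v i := fun i => by rw [← mulVec_mulVec]; exact hμ i
  have h4 := quadForm_le_of_mulVec_le hN hN0 hv hNv ya
  rw [CholeskyRun.dotProduct_transpose_mul_self_mulVec] at h4
  have hyy : ya ⬝ᵥ ya = y ⬝ᵥ y := by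
    simp only [dotProduct, hya]; exact sum_congr rfl fun i _ => abs_mul_abs_self _
  have hxx : 0 ≤ y ⬝ᵥ y := sum_nonneg fun i _ => mul_self_nonneg _
  have hcs : (ya ⬝ᵥ (Rad *ᵥ ya)) ^ 2 ≤ (ya ⬝ᵥ ya) * ((Rad *ᵥ ya) ⬝ᵥ (Rad *ᵥ ya)) := by
    have := sum_mul_sq_le_sq_mul_sq univ ya (Rad *ᵥ ya)
    simp only [dotProduct]
    calc (∑ i, ya i * (Rad *ᵥ ya) i) ^ 2 ≤ (∑ i, ya i ^ 2) * ∑ i, (Rad *ᵥ ya) i ^ 2 := this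
      _ = _ := by simp only [sq]
  have hb : ya ⬝ᵥ (Rad *ᵥ ya) ≤ r * (y ⬝ᵥ y) := by
    have hsq : (ya ⬝ᵥ (Rad *ᵥ ya)) ^ 2 ≤ (r * (y ⬝ᵥ y)) ^ 2 := by
      rw [hyy] at hcs h4
      calc (ya ⬝ᵥ (Rad *ᵥ ya)) ^ 2 ≤ (y ⬝ᵥ y) * ((Rad *ᵥ ya) ⬝ᵥ (Rad *ᵥ ya)) := hcs
        _ ≤ (y ⬝ᵥ y) * (μ * (y ⬝ᵥ y)) := mul_le_mul_of_nonneg_left h4 hxx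
        _ ≤ (y ⬝ᵥ y) * (r ^ 2 * (y ⬝ᵥ y)) :=
            mul_le_mul_of_nonneg_left (mul_le_mul_of_nonneg_right hμr hxx) hxx
        _ = (r * (y ⬝ᵥ y)) ^ 2 := by ring
    exact (abs_le.mp (abs_le_of_sq_le_sq hsq (mul_nonneg hr0 hxx))).2
  nlinarith [mul_le_mul_of_nonneg_right hc hxx]

end Cholesky

end Literature.ComputerArithmetic.Rump2006
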